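import Summits.QuantumFields.YangMills.Theses.BalabanLadder
import Summits.QuantumFields.YangMills.Theses.BalabanFamilyExport
import Summits.QuantumFields.YangMills.Theses.BalabanFluctuationExport
import Summits.QuantumFields.YangMills.Theorems.BalabanLadderUVTorusClassDefs
import Summits.QuantumFields.YangMills.Theorems.BalabanLadderUVTorusDictionary
import Literature.MathematicalPhysics.QuantumFieldTheory.Balaban1983to89.BlockAveragingSU2
import HarnessLib

/-!
# Line `per_insertion_regimes` — the conditional decoupling cut by the regime of EACH insertion (critic's sharpening of LINE 5)
(D-0145 ideator ym-idea-9 g2, LINE 7, lens «complete»; answers VERDICT #16 price (1))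

Skeleton for the crux `Summit.QuantumFields.YangMills.Theses.BalabanLadder.UVSeamRec` (stmt-QuantumFields-20043).  LINE 5 split
`CondDecoupling` (26017) into `SmallFieldDecoupling` (26272: test functions supported where the block field is δ-small near EVERY
insertion) and `RoughFieldDecoupling` (26273: supported on the complement).  The critic observed that 26273 as cut also owns every
MIXED configuration (rough near insertion 1, small near insertions 2…n) and must run both engines at once with the full power n.
This line types the per-insertion cut: `MixedRegimeDecoupling` (∃δ) asks the bound `(C/b⁴)ⁿ ∫|Ψ∘Q_k|` separately for each proper
regime `S ⊊ Fin n` («δ-small near the insertions of S, not δ-small near the others») — every insertion in a DEFINITE regime — and the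
PROVED glue sums the `2ⁿ` regimes WITHOUT LOSS: the regimes partition the block fields, `Ψ = Σ_S Ψ·χ_{R_S}` and
`Σ_S ∫|Ψ·χ_{R_S}∘Q_k| = ∫|Ψ∘Q_k|`, the regime `S = univ` being `SmallFieldDecoupling` at the same δ.  Results (no sorry outside stubs):
`condDecoupling_of_regimes : SmallFieldDecoupling → MixedRegimeDecoupling → CondDecoupling` (26017; the measurability support 26274
is proved inline, not assumed), `roughFieldDecoupling_of_mixed : MixedRegimeDecoupling → RoughFieldDecoupling` (26273 is exactly the
`S ≠ univ` half), and `UVSeamRec_holds_of_stubs` (the file's only theorem concluding the crux) BY NAME through `BalabanFluctuationExport.closes`.  The six registered stubs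
are route items by name except `stub_mixedRegimeDecoupling` (this line's statement; item-level adoption would be
`route edit --resplit CondDecoupling --into SmallFieldDecoupling MixedRegimeDecoupling`, at the tenure planner's discretion).
No summit, leg or spine crux is proved here.
-/

set_option autoImplicit false

namespace Summit.QuantumFields.YangMills.Cruxes.UVSeamRec.PerInsertionRegimes

open MeasureTheory
open Literature.MathematicalPhysics.QuantumFieldTheory
open Literature.MathematicalPhysics.QuantumFieldTheory.Balaban1983to89
open Literature.MathematicalPhysics.QuantumFieldTheory.Balaban1983to89.T4Continuum
open Literature.MathematicalPhysics.QuantumLattice (LGConfig torusLift fundamentalLatticeRep)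
open Summit.QuantumFields.YangMills.Cruxes.OSLegsFromFemtoAndGap.DlrCollarTransfer (plane)
open Summit.QuantumFields.YangMills.Cruxes.UV.TorusClass (torusEOn MomentBounds6OnSides)
open Summit.QuantumFields.YangMills.Theses.BalabanFluctuationExport

/-- the line's new statement «MixedRegimeDecoupling» (registered stub `stub_mixedRegimeDecoupling`) — conditional decoupling regime by regime: for SOME δ ∈ (0,1], every proper regime
`S ⊊ Fin n` and every bounded test function of the block field supported on «δ-small near the insertions of S, not δ-small near
the others», the centred product integrates to at most `(C/b⁴)ⁿ ∫|Ψ∘Q_k|`. -/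
def MixedRegimeDecoupling : Prop :=
  letI : MeasurableSpace (Matrix.specialUnitaryGroup (Fin 2) ℂ) := borel _
  haveI : BorelSpace (Matrix.specialUnitaryGroup (Fin 2) ℂ) := ⟨rfl⟩
  ∀ L : ℕ, Odd L → 11 < L → ∃ δ : ℝ, 0 < δ ∧ δ ≤ 1 ∧
  ∃ (C β₄ ℓ₄ : ℝ), 0 < ℓ₄ ∧ 0 ≤ C ∧ ∀ β : ℝ, β₄ ≤ β →
    ∀ (F : T4Family) (K k : ℕ), F.L = L → k + 1 ≤ F.m + K →
      ((L : ℝ) ^ k) * Summit.QuantumFields.YangMills.Cruxes.UVSeamRec.Transport.uRec β ≤ ℓ₄ →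
      haveI : NeZero ((F.P K).sitesPerDir 0) := ⟨Params.sitesPerDir_ne_zero _ _⟩
      let Q : GaugeConfig 4 ((F.P K).sitesPerDir 0) (Matrix.specialUnitaryGroup (Fin 2) ℂ) →
          GaugeField (F.P K) k (Matrix.specialUnitaryGroup (Fin 2) ℂ) :=
        fun V => Averaging.iter (fun j => BlockAveraging.blockAvg (P := F.P K) (j := j) su2Mean) k (ofConfig (P := F.P K) (j := 0) V)
      let μ := wilsonMeasure (d := 4) (L := (F.P K).sitesPerDir 0) (fundamentalLatticeRep 2).ρ β
      ∀ (n : ℕ) (q : Fin n → Fin 4 × Fin 4) (x : Fin n → (Fin 4 → ℤ)), (∀ i, (q i).1 < (q i).2) →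
        (∀ i j : Fin n, i ≠ j → ∃ κ : Fin 4,
          (2 * ((L : ℤ) ^ k) + 4) ≤ |((((x i κ - x j κ : ℤ) : ZMod ((F.P K).sitesPerDir 0))).valMinAbs : ℤ)|) →
        let p : Fin n → GaugeConfig 4 ((F.P K).sitesPerDir 0) (Matrix.specialUnitaryGroup (Fin 2) ℂ) → ℝ :=
          fun i V => plane (Matrix.specialUnitaryGroup (Fin 2) ℂ) (fundamentalLatticeRep 2) (q i) (x i) (torusLift ((F.P K).sitesPerDir 0) V)
        let cs : Fin n → Site (F.P K) k :=
          fun i ν => (((((x i ν : ℤ) : ZMod ((F.P K).sitesPerDir 0))).val / F.L ^ k : ℕ) : ZMod ((F.P K).sitesPerDir k))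
        let SmAt : Fin n → GaugeField (F.P K) k (Matrix.specialUnitaryGroup (Fin 2) ℂ) → Prop :=
          fun i W => PlaqSmallOn {pl : Plaq (F.P K) k | Site.tdist pl.src (cs i) ≤ 2} δ W
        ∀ g : Fin n → (GaugeField (F.P K) k (Matrix.specialUnitaryGroup (Fin 2) ℂ) → ℝ),
          (∃ D : ℝ, ∀ i W, |g i W| ≤ D) → (∀ i, Measurable (fun V => g i (Q V))) →
          (∀ i, ∀ φ : GaugeField (F.P K) k (Matrix.specialUnitaryGroup (Fin 2) ℂ) → ℝ,
            Measurable (fun V => φ (Q V)) → (∀ W, |φ W| ≤ 1) → ∫ V, (p i V - g i (Q V)) * φ (Q V) ∂μ = 0) →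
          ∀ S : Finset (Fin n), S ≠ Finset.univ →
          ∀ Ψ : GaugeField (F.P K) k (Matrix.specialUnitaryGroup (Fin 2) ℂ) → ℝ,
            Measurable (fun V => Ψ (Q V)) → (∀ W, |Ψ W| ≤ 1) → (∀ W, ¬ (∀ i, i ∈ S ↔ SmAt i W) → Ψ W = 0) →
            |∫ V, (∏ i, (p i V - g i (Q V))) * Ψ (Q V) ∂μ| ≤ (C / ((L : ℝ) ^ k) ^ 4) ^ n * ∫ V, |Ψ (Q V)| ∂μ


/-! ## Registered stubs -/

/-- stub (route item 26272, crux): conditional decoupling for test functions supported on block fields δ-small near EVERY insertion, every δ. -/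
theorem stub_smallFieldDecoupling : SmallFieldDecoupling := by
  sorry

/-- stub (this line's statement, hardest): conditional decoupling regime by regime, `S ⊊ Fin n`, some δ ∈ (0,1]. -/
theorem stub_mixedRegimeDecoupling : MixedRegimeDecoupling := by
  sorry

/-- stub (route item 26018, crux; split separately by the sibling line `response_regime_split`): one-point conditional response. -/
theorem stub_condResponse : CondResponse := by
  sorry

/-- stub (route item 26019, support/glue of the parent route): martingale telescoping to the family ceilings. -/
theorem stub_fluctuationExportGlue : FluctuationExportGlue := by
  sorry

/-- stub (route item 25033, crux): the family seam. -/
theorem stub_familySeam : FamilySeam := by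
  sorry

/-- stub (route item 25034, crux): the floors engine. -/
theorem stub_floorsEngine : FloorsEngine := by
  sorry

/-! ## Measurability of the block-average map and of the single-block small-field event (as in LINE 5's `smallEventMeasurable_holds`). -/

theorem measurable_blockField (F : T4Family) (K k : ℕ) :
    letI : MeasurableSpace (Matrix.specialUnitaryGroup (Fin 2) ℂ) := borel _
    Measurable (fun V : GaugeConfig 4 ((F.P K).sitesPerDir 0) (Matrix.specialUnitaryGroup (Fin 2) ℂ) =>
      Averaging.iter (fun j => BlockAveraging.blockAvg (P := F.P K) (j := j) su2Mean) k (ofConfig (P := F.P K) (j := 0) V)) := by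
  letI : MeasurableSpace (Matrix.specialUnitaryGroup (Fin 2) ℂ) := borel _
  haveI : BorelSpace (Matrix.specialUnitaryGroup (Fin 2) ℂ) := ⟨rfl⟩
  have hav : ∀ j, Measurable (fun U : GaugeField (F.P K) j (Matrix.specialUnitaryGroup (Fin 2) ℂ) =>
      (BlockAveraging.blockAvg (P := F.P K) (j := j) su2Mean).avg U) :=
    fun j => BlockAveraging.measurable_avgFun (P := F.P K) (j := j) su2Mean measurable_su2Mean_E
  have hiter : ∀ k', Measurable (Averaging.iter (P := F.P K) (G := Matrix.specialUnitaryGroup (Fin 2) ℂ)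
      (fun j => BlockAveraging.blockAvg (P := F.P K) (j := j) su2Mean) k') := by
    intro k'
    induction k' with
    | zero => exact measurable_id
    | succ k' ih => exact (hav k').comp ih
  have hof : Measurable (fun V : GaugeConfig 4 ((F.P K).sitesPerDir 0) (Matrix.specialUnitaryGroup (Fin 2) ℂ) =>
      ofConfig (P := F.P K) (j := 0) V) :=
    measurable_pi_lambda _ fun b => measurable_pi_apply _
  exact (hiter k).comp hof

theorem measurableSet_plaqSmallOn (F : T4Family) (K k : ℕ) (S : Set (Plaq (F.P K) k)) (δ : ℝ) :
    letI : MeasurableSpace (Matrix.specialUnitaryGroup (Fin 2) ℂ) := borel _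
    MeasurableSet {W : GaugeField (F.P K) k (Matrix.specialUnitaryGroup (Fin 2) ℂ) | PlaqSmallOn S δ W} := by
  letI : MeasurableSpace (Matrix.specialUnitaryGroup (Fin 2) ℂ) := borel _
  haveI : BorelSpace (Matrix.specialUnitaryGroup (Fin 2) ℂ) := ⟨rfl⟩
  have hpl : ∀ pl : Plaq (F.P K) k, Measurable (fun W : GaugeField (F.P K) k (Matrix.specialUnitaryGroup (Fin 2) ℂ) =>
      dist1 (GaugeField.plaqHol W pl)) := fun pl => by
    have hb : ∀ b : PBond (F.P K) k, Continuous fun U : (PBond (F.P K) k → Matrix.specialUnitaryGroup (Fin 2) ℂ) => U b :=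
      fun b => continuous_apply b
    have hc : Continuous fun U : (PBond (F.P K) k → Matrix.specialUnitaryGroup (Fin 2) ℂ) =>
        GaugeField.plaqHol (P := F.P K) (j := k) U pl := by
      unfold GaugeField.plaqHol
      exact (((hb _).mul (hb _)).mul (hb _).inv).mul (hb _).inv
    have hm : Measurable fun U : (PBond (F.P K) k → Matrix.specialUnitaryGroup (Fin 2) ℂ) =>
        dist1 (GaugeField.plaqHol (P := F.P K) (j := k) U pl) :=
      RegularGaugeGroup.measurable_dist1.comp hc.measurable
    exact hm
  have : {W : GaugeField (F.P K) k (Matrix.specialUnitaryGroup (Fin 2) ℂ) | PlaqSmallOn S δ W}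
      = ⋂ pl ∈ S, {W | dist1 (GaugeField.plaqHol W pl) < δ} := by
    ext W; simp only [PlaqSmallOn, Set.mem_setOf_eq, Set.mem_iInter]
  rw [this]
  exact MeasurableSet.biInter (Set.to_countable _) fun pl _ => measurableSet_lt (hpl pl) measurable_const

/-- restatement (expanded, `Iff.rfl` to the filed compact text — see line4/final_defs.lean) of the parent crux
`BalabanFluctuationExport.CondDecoupling` (item 26017), the target of the glue. -/
def CondDecouplingX : Prop :=
  letI : MeasurableSpace (Matrix.specialUnitaryGroup (Fin 2) ℂ) := borel _
  haveI : BorelSpace (Matrix.specialUnitaryGroup (Fin 2) ℂ) := ⟨rfl⟩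
  ∀ L : ℕ, Odd L → 11 < L →
  ∃ (C β₄ ℓ₄ : ℝ), 0 < ℓ₄ ∧ 0 ≤ C ∧ ∀ β : ℝ, β₄ ≤ β →
    ∀ (F : T4Family) (K k : ℕ), F.L = L → k + 1 ≤ F.m + K →
      ((L : ℝ) ^ k) * Summit.QuantumFields.YangMills.Cruxes.UVSeamRec.Transport.uRec β ≤ ℓ₄ →
      haveI : NeZero ((F.P K).sitesPerDir 0) := ⟨Params.sitesPerDir_ne_zero _ _⟩
      ∀ (n : ℕ) (q : Fin n → Fin 4 × Fin 4) (x : Fin n → (Fin 4 → ℤ)), (∀ i, (q i).1 < (q i).2) →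
        (∀ i j : Fin n, i ≠ j → ∃ κ : Fin 4,
          (2 * ((L : ℤ) ^ k) + 4) ≤ |((((x i κ - x j κ : ℤ) : ZMod ((F.P K).sitesPerDir 0))).valMinAbs : ℤ)|) →
        ∀ g : Fin n → (GaugeField (F.P K) k (Matrix.specialUnitaryGroup (Fin 2) ℂ) → ℝ),
          (∃ D : ℝ, ∀ i W, |g i W| ≤ D) →
          (∀ i, Measurable (fun V : GaugeConfig 4 ((F.P K).sitesPerDir 0) (Matrix.specialUnitaryGroup (Fin 2) ℂ) =>
              g i (Averaging.iter (fun j => BlockAveraging.blockAvg (P := F.P K) (j := j) su2Mean) k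
                (ofConfig (P := F.P K) (j := 0) V)))) →
          (∀ i, ∀ φ : GaugeField (F.P K) k (Matrix.specialUnitaryGroup (Fin 2) ℂ) → ℝ,
            Measurable (fun V : GaugeConfig 4 ((F.P K).sitesPerDir 0) (Matrix.specialUnitaryGroup (Fin 2) ℂ) =>
              φ (Averaging.iter (fun j => BlockAveraging.blockAvg (P := F.P K) (j := j) su2Mean) k
                (ofConfig (P := F.P K) (j := 0) V))) →
            (∀ W, |φ W| ≤ 1) →
            ∫ V, (plane (Matrix.specialUnitaryGroup (Fin 2) ℂ) (fundamentalLatticeRep 2) (q i) (x i)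
                    (torusLift ((F.P K).sitesPerDir 0) V)
                  - g i (Averaging.iter (fun j => BlockAveraging.blockAvg (P := F.P K) (j := j) su2Mean) k
                      (ofConfig (P := F.P K) (j := 0) V)))
                * φ (Averaging.iter (fun j => BlockAveraging.blockAvg (P := F.P K) (j := j) su2Mean) k
                      (ofConfig (P := F.P K) (j := 0) V))
              ∂(wilsonMeasure (d := 4) (L := (F.P K).sitesPerDir 0) (fundamentalLatticeRep 2).ρ β) = 0) →
        ∀ Ψ : GaugeField (F.P K) k (Matrix.specialUnitaryGroup (Fin 2) ℂ) → ℝ,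
          Measurable (fun V : GaugeConfig 4 ((F.P K).sitesPerDir 0) (Matrix.specialUnitaryGroup (Fin 2) ℂ) =>
              Ψ (Averaging.iter (fun j => BlockAveraging.blockAvg (P := F.P K) (j := j) su2Mean) k
                (ofConfig (P := F.P K) (j := 0) V))) →
          (∀ W, |Ψ W| ≤ 1) →
          |∫ V, (∏ i, (plane (Matrix.specialUnitaryGroup (Fin 2) ℂ) (fundamentalLatticeRep 2) (q i) (x i)
                    (torusLift ((F.P K).sitesPerDir 0) V)
                  - g i (Averaging.iter (fun j => BlockAveraging.blockAvg (P := F.P K) (j := j) su2Mean) k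
                      (ofConfig (P := F.P K) (j := 0) V))))
                * Ψ (Averaging.iter (fun j => BlockAveraging.blockAvg (P := F.P K) (j := j) su2Mean) k
                      (ofConfig (P := F.P K) (j := 0) V))
              ∂(wilsonMeasure (d := 4) (L := (F.P K).sitesPerDir 0) (fundamentalLatticeRep 2).ρ β)|
            ≤ (C / ((L : ℝ) ^ k) ^ 4) ^ n *
              ∫ V, |Ψ (Averaging.iter (fun j => BlockAveraging.blockAvg (P := F.P K) (j := j) su2Mean) k
                      (ofConfig (P := F.P K) (j := 0) V))|
                ∂(wilsonMeasure (d := 4) (L := (F.P K).sitesPerDir 0) (fundamentalLatticeRep 2).ρ β)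

/-- `RoughFieldDecoupling` (26273) with its `let`s expanded (definitionally equal to the route decl). -/
def RoughFieldDecouplingX : Prop :=
  letI : MeasurableSpace (Matrix.specialUnitaryGroup (Fin 2) ℂ) := borel _
  haveI : BorelSpace (Matrix.specialUnitaryGroup (Fin 2) ℂ) := ⟨rfl⟩
  ∀ L : ℕ, Odd L → 11 < L → ∃ δ : ℝ, 0 < δ ∧ δ ≤ 1 ∧
  ∃ (C β₄ ℓ₄ : ℝ), 0 < ℓ₄ ∧ 0 ≤ C ∧ ∀ β : ℝ, β₄ ≤ β →
    ∀ (F : T4Family) (K k : ℕ), F.L = L → k + 1 ≤ F.m + K →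
      ((L : ℝ) ^ k) * Summit.QuantumFields.YangMills.Cruxes.UVSeamRec.Transport.uRec β ≤ ℓ₄ →
      haveI : NeZero ((F.P K).sitesPerDir 0) := ⟨Params.sitesPerDir_ne_zero _ _⟩
      ∀ (n : ℕ) (q : Fin n → Fin 4 × Fin 4) (x : Fin n → (Fin 4 → ℤ)), (∀ i, (q i).1 < (q i).2) →
        (∀ i j : Fin n, i ≠ j → ∃ κ : Fin 4,
          (2 * ((L : ℤ) ^ k) + 4) ≤ |((((x i κ - x j κ : ℤ) : ZMod ((F.P K).sitesPerDir 0))).valMinAbs : ℤ)|) →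
        ∀ g : Fin n → (GaugeField (F.P K) k (Matrix.specialUnitaryGroup (Fin 2) ℂ) → ℝ),
          (∃ D : ℝ, ∀ i W, |g i W| ≤ D) →
          (∀ i, Measurable (fun V : GaugeConfig 4 ((F.P K).sitesPerDir 0) (Matrix.specialUnitaryGroup (Fin 2) ℂ) =>
              g i (Averaging.iter (fun j => BlockAveraging.blockAvg (P := F.P K) (j := j) su2Mean) k
                (ofConfig (P := F.P K) (j := 0) V)))) →
          (∀ i, ∀ φ : GaugeField (F.P K) k (Matrix.specialUnitaryGroup (Fin 2) ℂ) → ℝ,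
            Measurable (fun V : GaugeConfig 4 ((F.P K).sitesPerDir 0) (Matrix.specialUnitaryGroup (Fin 2) ℂ) =>
              φ (Averaging.iter (fun j => BlockAveraging.blockAvg (P := F.P K) (j := j) su2Mean) k
                (ofConfig (P := F.P K) (j := 0) V))) →
            (∀ W, |φ W| ≤ 1) →
            ∫ V, (plane (Matrix.specialUnitaryGroup (Fin 2) ℂ) (fundamentalLatticeRep 2) (q i) (x i)
                    (torusLift ((F.P K).sitesPerDir 0) V)
                  - g i (Averaging.iter (fun j => BlockAveraging.blockAvg (P := F.P K) (j := j) su2Mean) k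
                      (ofConfig (P := F.P K) (j := 0) V)))
                * φ (Averaging.iter (fun j => BlockAveraging.blockAvg (P := F.P K) (j := j) su2Mean) k
                      (ofConfig (P := F.P K) (j := 0) V))
              ∂(wilsonMeasure (d := 4) (L := (F.P K).sitesPerDir 0) (fundamentalLatticeRep 2).ρ β) = 0) →
        ∀ Ψ : GaugeField (F.P K) k (Matrix.specialUnitaryGroup (Fin 2) ℂ) → ℝ,
          Measurable (fun V : GaugeConfig 4 ((F.P K).sitesPerDir 0) (Matrix.specialUnitaryGroup (Fin 2) ℂ) =>
              Ψ (Averaging.iter (fun j => BlockAveraging.blockAvg (P := F.P K) (j := j) su2Mean) k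
                (ofConfig (P := F.P K) (j := 0) V))) →
          (∀ W, |Ψ W| ≤ 1) →
          (∀ W, PlaqSmallOn {pl : Plaq (F.P K) k | ∃ i, Site.tdist pl.src
              ((fun (i : Fin n) (ν : Fin 4) => (((((x i ν : ℤ) : ZMod ((F.P K).sitesPerDir 0))).val / F.L ^ k : ℕ) :
                ZMod ((F.P K).sitesPerDir k))) i) ≤ 2} δ W → Ψ W = 0) →
          |∫ V, (∏ i, (plane (Matrix.specialUnitaryGroup (Fin 2) ℂ) (fundamentalLatticeRep 2) (q i) (x i)
                    (torusLift ((F.P K).sitesPerDir 0) V)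
                  - g i (Averaging.iter (fun j => BlockAveraging.blockAvg (P := F.P K) (j := j) su2Mean) k
                      (ofConfig (P := F.P K) (j := 0) V))))
                * Ψ (Averaging.iter (fun j => BlockAveraging.blockAvg (P := F.P K) (j := j) su2Mean) k
                      (ofConfig (P := F.P K) (j := 0) V))
              ∂(wilsonMeasure (d := 4) (L := (F.P K).sitesPerDir 0) (fundamentalLatticeRep 2).ρ β)|
            ≤ (C / ((L : ℝ) ^ k) ^ 4) ^ n *
              ∫ V, |Ψ (Averaging.iter (fun j => BlockAveraging.blockAvg (P := F.P K) (j := j) su2Mean) k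
                      (ofConfig (P := F.P K) (j := 0) V))|
                ∂(wilsonMeasure (d := 4) (L := (F.P K).sitesPerDir 0) (fundamentalLatticeRep 2).ρ β)


/-! ## The glue `SmallFieldDecoupling → MixedRegimeDecoupling → CondDecoupling` — PROVED (partition into the 2ⁿ regimes). -/

attribute [local instance] Classical.propDecidable in
theorem condDecoupling_of_perInsertionRegimes :
    SmallFieldDecoupling → MixedRegimeDecoupling → CondDecouplingX := by
  intro hS hMx
  letI : MeasurableSpace (Matrix.specialUnitaryGroup (Fin 2) ℂ) := borel _
  haveI : BorelSpace (Matrix.specialUnitaryGroup (Fin 2) ℂ) := ⟨rfl⟩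
  intro L hLo hL11
  obtain ⟨δ, hδ0, hδ1, C₂, β₂, ℓ₂, hℓ₂, hC₂, hMixed⟩ := hMx L hLo hL11
  obtain ⟨C₁, β₁, ℓ₁, hℓ₁, hC₁, hSmall⟩ := hS L hLo hL11 δ hδ0 hδ1
  refine ⟨max C₁ C₂, max β₁ β₂, min ℓ₁ ℓ₂, lt_min hℓ₁ hℓ₂, le_max_of_le_left hC₁, ?_⟩
  intro β hβ F K k hFL hk hb n q x hq hsep g hgb hgm horth Ψ hΨm hΨb
  haveI : NeZero ((F.P K).sitesPerDir 0) := ⟨Params.sitesPerDir_ne_zero _ _⟩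
  -- abbreviations
  set M : ℕ := (F.P K).sitesPerDir 0 with hMdef
  set Q : GaugeConfig 4 M (Matrix.specialUnitaryGroup (Fin 2) ℂ) →
      GaugeField (F.P K) k (Matrix.specialUnitaryGroup (Fin 2) ℂ) :=
    fun V => Averaging.iter (fun j => BlockAveraging.blockAvg (P := F.P K) (j := j) su2Mean) k
      (ofConfig (P := F.P K) (j := 0) V) with hQdef
  set μ : Measure (GaugeConfig 4 M (Matrix.specialUnitaryGroup (Fin 2) ℂ)) :=
    wilsonMeasure (d := 4) (L := M) (fundamentalLatticeRep 2).ρ β with hμdef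
  set T : GaugeConfig 4 M (Matrix.specialUnitaryGroup (Fin 2) ℂ) → ℝ :=
    fun V => ∏ i, (plane (Matrix.specialUnitaryGroup (Fin 2) ℂ) (fundamentalLatticeRep 2) (q i) (x i) (torusLift M V)
      - g i (Q V)) with hTdef
  let cs : Fin n → Site (F.P K) k :=
    fun i ν => (((((x i ν : ℤ) : ZMod ((F.P K).sitesPerDir 0))).val / F.L ^ k : ℕ) : ZMod ((F.P K).sitesPerDir k))
  let SmAt : Fin n → GaugeField (F.P K) k (Matrix.specialUnitaryGroup (Fin 2) ℂ) → Prop :=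
    fun i W => PlaqSmallOn {pl : Plaq (F.P K) k | Site.tdist pl.src (cs i) ≤ 2} δ W
  let Sm : GaugeField (F.P K) k (Matrix.specialUnitaryGroup (Fin 2) ℂ) → Prop :=
    fun W => PlaqSmallOn {pl : Plaq (F.P K) k | ∃ i, Site.tdist pl.src (cs i) ≤ 2} δ W
  -- the regime of a block field and the regime pieces of Ψ
  let InR : Finset (Fin n) → GaugeField (F.P K) k (Matrix.specialUnitaryGroup (Fin 2) ℂ) → Prop :=
    fun S W => ∀ i, i ∈ S ↔ SmAt i W
  let S₀ : GaugeField (F.P K) k (Matrix.specialUnitaryGroup (Fin 2) ℂ) → Finset (Fin n) :=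
    fun W => Finset.univ.filter fun i => SmAt i W
  have hInR_iff : ∀ S W, InR S W ↔ S₀ W = S := fun S W => by
    constructor
    · intro h; ext i; simp [S₀, Finset.mem_filter, h i]
    · intro h i; rw [← h]; simp [S₀, Finset.mem_filter]
  let ΨS : Finset (Fin n) → GaugeField (F.P K) k (Matrix.specialUnitaryGroup (Fin 2) ℂ) → ℝ :=
    fun S W => if InR S W then Ψ W else 0
  -- measurability of the regime events
  have hQm : Measurable Q := measurable_blockField F K k
  have hAt : ∀ i, MeasurableSet {V : GaugeConfig 4 M (Matrix.specialUnitaryGroup (Fin 2) ℂ) | SmAt i (Q V)} := fun i =>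
    hQm (measurableSet_plaqSmallOn F K k {pl : Plaq (F.P K) k | Site.tdist pl.src (cs i) ≤ 2} δ)
  have hR : ∀ S, MeasurableSet {V : GaugeConfig 4 M (Matrix.specialUnitaryGroup (Fin 2) ℂ) | InR S (Q V)} := fun S => by
    have : {V : GaugeConfig 4 M (Matrix.specialUnitaryGroup (Fin 2) ℂ) | InR S (Q V)}
        = ⋂ i : Fin n, (if i ∈ S then {V | SmAt i (Q V)} else {V | SmAt i (Q V)}ᶜ) := by
      ext V
      simp only [InR, Set.mem_setOf_eq, Set.mem_iInter]
      refine forall_congr' fun i => ?_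
      by_cases hi : i ∈ S <;> simp [hi]
    rw [this]
    exact MeasurableSet.iInter fun i => by
      by_cases hi : i ∈ S
      · simp only [hi, if_true]; exact hAt i
      · simp only [hi, if_false]; exact (hAt i).compl
  have hΨSm : ∀ S, Measurable (fun V => ΨS S (Q V)) := fun S => Measurable.ite (hR S) hΨm measurable_const
  have hΨSb : ∀ S W, |ΨS S W| ≤ 1 := fun S W => by
    by_cases h : InR S W <;> simp [ΨS, h, hΨb W]
  have hΨSsupp : ∀ S W, ¬ InR S W → ΨS S W = 0 := fun S W h => by simp [ΨS, h]
  -- the partition identities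
  have hsumΨ : ∀ W, ∑ S, ΨS S W = Ψ W := fun W => by
    have : ∀ S, ΨS S W = if S = S₀ W then Ψ W else 0 := fun S => by
      by_cases h : InR S W
      · have hS0 : S₀ W = S := (hInR_iff S W).mp h
        simp [ΨS, h, hS0]
      · have : S ≠ S₀ W := fun h' => h ((hInR_iff S W).mpr h'.symm)
        simp [ΨS, h, this]
    simp_rw [this]
    simp [Finset.sum_ite_eq']
  have hsumabs : ∀ W, ∑ S, |ΨS S W| = |Ψ W| := fun W => by
    have : ∀ S, |ΨS S W| = if S = S₀ W then |Ψ W| else 0 := fun S => by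
      by_cases h : InR S W
      · have hS0 : S₀ W = S := (hInR_iff S W).mp h
        simp [ΨS, h, hS0]
      · have : S ≠ S₀ W := fun h' => h ((hInR_iff S W).mpr h'.symm)
        simp [ΨS, h, this]
    simp_rw [this]
    simp [Finset.sum_ite_eq']
  -- the universal regime is inside LINE 5's small-field event
  have hUnivSm : ∀ W, ¬ Sm W → ΨS Finset.univ W = 0 := fun W hW => by
    have : ¬ InR Finset.univ W := fun h => hW (by
      intro pl hpl
      obtain ⟨i, hi⟩ := hpl
      exact (h i).mp (Finset.mem_univ i) pl hi)
    simp [ΨS, this]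
  -- windows and the per-regime bounds
  have hb₁ : ((L : ℝ) ^ k) * Summit.QuantumFields.YangMills.Cruxes.UVSeamRec.Transport.uRec β ≤ ℓ₁ := hb.trans (min_le_left _ _)
  have hb₂ : ((L : ℝ) ^ k) * Summit.QuantumFields.YangMills.Cruxes.UVSeamRec.Transport.uRec β ≤ ℓ₂ := hb.trans (min_le_right _ _)
  have hLpos : (0 : ℝ) < ((L : ℝ) ^ k) ^ 4 := by positivity
  have hq₁ : (C₁ / ((L : ℝ) ^ k) ^ 4) ^ n ≤ (max C₁ C₂ / ((L : ℝ) ^ k) ^ 4) ^ n :=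
    pow_le_pow_left₀ (div_nonneg hC₁ hLpos.le) (div_le_div_of_nonneg_right (le_max_left _ _) hLpos.le) n
  have hq₂ : (C₂ / ((L : ℝ) ^ k) ^ 4) ^ n ≤ (max C₁ C₂ / ((L : ℝ) ^ k) ^ 4) ^ n :=
    pow_le_pow_left₀ (div_nonneg hC₂ hLpos.le) (div_le_div_of_nonneg_right (le_max_right _ _) hLpos.le) n
  have hper : ∀ S, |∫ V, T V * ΨS S (Q V) ∂μ| ≤ (max C₁ C₂ / ((L : ℝ) ^ k) ^ 4) ^ n * ∫ V, |ΨS S (Q V)| ∂μ := by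
    intro S
    have hI0 : 0 ≤ ∫ V, |ΨS S (Q V)| ∂μ := integral_nonneg fun V => abs_nonneg _
    by_cases hS : S = Finset.univ
    · subst hS
      have h1 : |∫ V, T V * ΨS Finset.univ (Q V) ∂μ| ≤ (C₁ / ((L : ℝ) ^ k) ^ 4) ^ n * ∫ V, |ΨS Finset.univ (Q V)| ∂μ :=
        hSmall β ((le_max_left _ _).trans hβ) F K k hFL hk hb₁ n q x hq hsep g hgb hgm horth (ΨS Finset.univ)
          (hΨSm _) (hΨSb _) hUnivSm
      exact h1.trans (mul_le_mul_of_nonneg_right hq₁ hI0)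
    · have h2 : |∫ V, T V * ΨS S (Q V) ∂μ| ≤ (C₂ / ((L : ℝ) ^ k) ^ 4) ^ n * ∫ V, |ΨS S (Q V)| ∂μ :=
        hMixed β ((le_max_right _ _).trans hβ) F K k hFL hk hb₂ n q x hq hsep g hgb hgm horth S hS (ΨS S)
          (hΨSm S) (hΨSb S) (hΨSsupp S)
      exact h2.trans (mul_le_mul_of_nonneg_right hq₂ hI0)
  -- integrability bookkeeping
  haveI : IsProbabilityMeasure μ :=
    isProbabilityMeasure_wilsonMeasure (d := 4) (L := M) (fundamentalLatticeRep 2).ρ (fundamentalLatticeRep 2).continuous β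
  obtain ⟨D, hD⟩ := hgb
  obtain ⟨B, hB⟩ := Summit.QuantumFields.YangMills.Cruxes.OSLegsFromFemtoAndGap.DlrCollarTransfer.exists_abs_plane_le
    (G := Matrix.specialUnitaryGroup (Fin 2) ℂ) (fundamentalLatticeRep 2)
  have hTm : Measurable T := by
    refine Finset.measurable_prod _ fun i _ => ?_
    exact ((Summit.QuantumFields.YangMills.Cruxes.OSLegsFromFemtoAndGap.DlrCollarTransfer.continuous_plane
      (G := Matrix.specialUnitaryGroup (Fin 2) ℂ) (fundamentalLatticeRep 2) (q i) (x i)).measurable.comp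
      (measurable_torusLift (d := 4) (G := Matrix.specialUnitaryGroup (Fin 2) ℂ) M)).sub (hgm i)
  have hTb : ∀ V, |T V| ≤ (B + D) ^ n := fun V => by
    simp only [hTdef, Finset.abs_prod]
    calc ∏ i, |plane (Matrix.specialUnitaryGroup (Fin 2) ℂ) (fundamentalLatticeRep 2) (q i) (x i) (torusLift M V) - g i (Q V)|
        ≤ ∏ _i : Fin n, (B + D) := Finset.prod_le_prod (fun i _ => abs_nonneg _) fun i _ =>
            (abs_sub _ _).trans (add_le_add (hB _ _ _) (hD _ _))
      _ = (B + D) ^ n := by simp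
  have hint : ∀ χ : GaugeField (F.P K) k (Matrix.specialUnitaryGroup (Fin 2) ℂ) → ℝ,
      Measurable (fun V => χ (Q V)) → (∀ W, |χ W| ≤ 1) → Integrable (fun V => T V * χ (Q V)) μ := fun χ hχm hχb => by
    refine Integrable.mono' (integrable_const ((B + D) ^ n * 1)) (hTm.mul hχm).aestronglyMeasurable
      (Filter.Eventually.of_forall fun V => ?_)
    rw [Real.norm_eq_abs, abs_mul]
    exact mul_le_mul (hTb V) (hχb _) (abs_nonneg _) ((abs_nonneg _).trans (hTb V))
  have hintabs : ∀ χ : GaugeField (F.P K) k (Matrix.specialUnitaryGroup (Fin 2) ℂ) → ℝ,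
      Measurable (fun V => χ (Q V)) → (∀ W, |χ W| ≤ 1) → Integrable (fun V => |χ (Q V)|) μ := fun χ hχm hχb => by
    refine Integrable.mono' (integrable_const (1 : ℝ)) hχm.abs.aestronglyMeasurable (Filter.Eventually.of_forall fun V => ?_)
    rw [Real.norm_eq_abs, abs_abs]; exact hχb _
  -- sum the regimes
  have hI : ∫ V, T V * Ψ (Q V) ∂μ = ∑ S, ∫ V, T V * ΨS S (Q V) ∂μ := by
    rw [← integral_finsetSum _ (fun S _ => hint (ΨS S) (hΨSm S) (hΨSb S))]
    refine integral_congr_ae (Filter.Eventually.of_forall fun V => ?_)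
    simp only
    rw [← Finset.mul_sum, hsumΨ]
  have hIabs : ∫ V, |Ψ (Q V)| ∂μ = ∑ S, ∫ V, |ΨS S (Q V)| ∂μ := by
    rw [← integral_finsetSum _ (fun S _ => hintabs (ΨS S) (hΨSm S) (hΨSb S))]
    exact integral_congr_ae (Filter.Eventually.of_forall fun V => (hsumabs (Q V)).symm)
  show |∫ V, T V * Ψ (Q V) ∂μ| ≤ (max C₁ C₂ / ((L : ℝ) ^ k) ^ 4) ^ n * ∫ V, |Ψ (Q V)| ∂μ
  rw [hI, hIabs, Finset.mul_sum]
  exact (Finset.abs_sum_le_sum_abs _ _).trans (Finset.sum_le_sum fun S _ => hper S)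

/-! `RoughFieldDecoupling` (26273) is the `S ≠ univ` half of the partition: it follows from `MixedRegimeDecoupling` ALONE (PROVED). -/

attribute [local instance] Classical.propDecidable in
theorem roughFieldDecoupling_of_mixedX : MixedRegimeDecoupling → RoughFieldDecouplingX := by
  intro hMx
  letI : MeasurableSpace (Matrix.specialUnitaryGroup (Fin 2) ℂ) := borel _
  haveI : BorelSpace (Matrix.specialUnitaryGroup (Fin 2) ℂ) := ⟨rfl⟩
  intro L hLo hL11
  obtain ⟨δ, hδ0, hδ1, C₂, β₂, ℓ₂, hℓ₂, hC₂, hMixed⟩ := hMx L hLo hL11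
  refine ⟨δ, hδ0, hδ1, C₂, β₂, ℓ₂, hℓ₂, hC₂, ?_⟩
  intro β hβ F K k hFL hk hb n q x hq hsep g hgb hgm horth Ψ hΨm hΨb hΨs
  haveI : NeZero ((F.P K).sitesPerDir 0) := ⟨Params.sitesPerDir_ne_zero _ _⟩
  -- abbreviations
  set M : ℕ := (F.P K).sitesPerDir 0 with hMdef
  set Q : GaugeConfig 4 M (Matrix.specialUnitaryGroup (Fin 2) ℂ) →
      GaugeField (F.P K) k (Matrix.specialUnitaryGroup (Fin 2) ℂ) :=
    fun V => Averaging.iter (fun j => BlockAveraging.blockAvg (P := F.P K) (j := j) su2Mean) k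
      (ofConfig (P := F.P K) (j := 0) V) with hQdef
  set μ : Measure (GaugeConfig 4 M (Matrix.specialUnitaryGroup (Fin 2) ℂ)) :=
    wilsonMeasure (d := 4) (L := M) (fundamentalLatticeRep 2).ρ β with hμdef
  set T : GaugeConfig 4 M (Matrix.specialUnitaryGroup (Fin 2) ℂ) → ℝ :=
    fun V => ∏ i, (plane (Matrix.specialUnitaryGroup (Fin 2) ℂ) (fundamentalLatticeRep 2) (q i) (x i) (torusLift M V)
      - g i (Q V)) with hTdef
  let cs : Fin n → Site (F.P K) k :=
    fun i ν => (((((x i ν : ℤ) : ZMod ((F.P K).sitesPerDir 0))).val / F.L ^ k : ℕ) : ZMod ((F.P K).sitesPerDir k))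
  let SmAt : Fin n → GaugeField (F.P K) k (Matrix.specialUnitaryGroup (Fin 2) ℂ) → Prop :=
    fun i W => PlaqSmallOn {pl : Plaq (F.P K) k | Site.tdist pl.src (cs i) ≤ 2} δ W
  let Sm : GaugeField (F.P K) k (Matrix.specialUnitaryGroup (Fin 2) ℂ) → Prop :=
    fun W => PlaqSmallOn {pl : Plaq (F.P K) k | ∃ i, Site.tdist pl.src (cs i) ≤ 2} δ W
  -- the regime of a block field and the regime pieces of Ψ
  let InR : Finset (Fin n) → GaugeField (F.P K) k (Matrix.specialUnitaryGroup (Fin 2) ℂ) → Prop :=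
    fun S W => ∀ i, i ∈ S ↔ SmAt i W
  let S₀ : GaugeField (F.P K) k (Matrix.specialUnitaryGroup (Fin 2) ℂ) → Finset (Fin n) :=
    fun W => Finset.univ.filter fun i => SmAt i W
  have hInR_iff : ∀ S W, InR S W ↔ S₀ W = S := fun S W => by
    constructor
    · intro h; ext i; simp [S₀, Finset.mem_filter, h i]
    · intro h i; rw [← h]; simp [S₀, Finset.mem_filter]
  let ΨS : Finset (Fin n) → GaugeField (F.P K) k (Matrix.specialUnitaryGroup (Fin 2) ℂ) → ℝ :=
    fun S W => if InR S W then Ψ W else 0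
  -- measurability of the regime events
  have hQm : Measurable Q := measurable_blockField F K k
  have hAt : ∀ i, MeasurableSet {V : GaugeConfig 4 M (Matrix.specialUnitaryGroup (Fin 2) ℂ) | SmAt i (Q V)} := fun i =>
    hQm (measurableSet_plaqSmallOn F K k {pl : Plaq (F.P K) k | Site.tdist pl.src (cs i) ≤ 2} δ)
  have hR : ∀ S, MeasurableSet {V : GaugeConfig 4 M (Matrix.specialUnitaryGroup (Fin 2) ℂ) | InR S (Q V)} := fun S => by
    have : {V : GaugeConfig 4 M (Matrix.specialUnitaryGroup (Fin 2) ℂ) | InR S (Q V)}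
        = ⋂ i : Fin n, (if i ∈ S then {V | SmAt i (Q V)} else {V | SmAt i (Q V)}ᶜ) := by
      ext V
      simp only [InR, Set.mem_setOf_eq, Set.mem_iInter]
      refine forall_congr' fun i => ?_
      by_cases hi : i ∈ S <;> simp [hi]
    rw [this]
    exact MeasurableSet.iInter fun i => by
      by_cases hi : i ∈ S
      · simp only [hi, if_true]; exact hAt i
      · simp only [hi, if_false]; exact (hAt i).compl
  have hΨSm : ∀ S, Measurable (fun V => ΨS S (Q V)) := fun S => Measurable.ite (hR S) hΨm measurable_const
  have hΨSb : ∀ S W, |ΨS S W| ≤ 1 := fun S W => by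
    by_cases h : InR S W <;> simp [ΨS, h, hΨb W]
  have hΨSsupp : ∀ S W, ¬ InR S W → ΨS S W = 0 := fun S W h => by simp [ΨS, h]
  -- the partition identities
  have hsumΨ : ∀ W, ∑ S, ΨS S W = Ψ W := fun W => by
    have : ∀ S, ΨS S W = if S = S₀ W then Ψ W else 0 := fun S => by
      by_cases h : InR S W
      · have hS0 : S₀ W = S := (hInR_iff S W).mp h
        simp [ΨS, h, hS0]
      · have : S ≠ S₀ W := fun h' => h ((hInR_iff S W).mpr h'.symm)
        simp [ΨS, h, this]
    simp_rw [this]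
    simp [Finset.sum_ite_eq']
  have hsumabs : ∀ W, ∑ S, |ΨS S W| = |Ψ W| := fun W => by
    have : ∀ S, |ΨS S W| = if S = S₀ W then |Ψ W| else 0 := fun S => by
      by_cases h : InR S W
      · have hS0 : S₀ W = S := (hInR_iff S W).mp h
        simp [ΨS, h, hS0]
      · have : S ≠ S₀ W := fun h' => h ((hInR_iff S W).mpr h'.symm)
        simp [ΨS, h, this]
    simp_rw [this]
    simp [Finset.sum_ite_eq']
  -- on the universal regime Ψ vanishes (it is supported on rough block fields)
  have hUniv0 : ∀ W, ΨS Finset.univ W = 0 := fun W => by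
    by_cases h : InR Finset.univ W
    · have hSmW : Sm W := by
        intro pl hpl
        obtain ⟨i, hi⟩ := hpl
        exact (h i).mp (Finset.mem_univ i) pl hi
      simp [ΨS, h, hΨs W hSmW]
    · simp [ΨS, h]
  -- windows and the per-regime bounds
  have hLpos : (0 : ℝ) < ((L : ℝ) ^ k) ^ 4 := by positivity
  have hper : ∀ S, |∫ V, T V * ΨS S (Q V) ∂μ| ≤ (C₂ / ((L : ℝ) ^ k) ^ 4) ^ n * ∫ V, |ΨS S (Q V)| ∂μ := by
    intro S
    have hI0 : 0 ≤ ∫ V, |ΨS S (Q V)| ∂μ := integral_nonneg fun V => abs_nonneg _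
    by_cases hS : S = Finset.univ
    · subst hS
      have h0 : ∫ V, T V * ΨS Finset.univ (Q V) ∂μ = 0 := by
        simp [hUniv0]
      rw [h0, abs_zero]
      exact mul_nonneg (pow_nonneg (div_nonneg hC₂ hLpos.le) n) hI0
    · exact hMixed β hβ F K k hFL hk hb n q x hq hsep g hgb hgm horth S hS (ΨS S) (hΨSm S) (hΨSb S) (hΨSsupp S)
  -- integrability bookkeeping
  haveI : IsProbabilityMeasure μ :=
    isProbabilityMeasure_wilsonMeasure (d := 4) (L := M) (fundamentalLatticeRep 2).ρ (fundamentalLatticeRep 2).continuous β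
  obtain ⟨D, hD⟩ := hgb
  obtain ⟨B, hB⟩ := Summit.QuantumFields.YangMills.Cruxes.OSLegsFromFemtoAndGap.DlrCollarTransfer.exists_abs_plane_le
    (G := Matrix.specialUnitaryGroup (Fin 2) ℂ) (fundamentalLatticeRep 2)
  have hTm : Measurable T := by
    refine Finset.measurable_prod _ fun i _ => ?_
    exact ((Summit.QuantumFields.YangMills.Cruxes.OSLegsFromFemtoAndGap.DlrCollarTransfer.continuous_plane
      (G := Matrix.specialUnitaryGroup (Fin 2) ℂ) (fundamentalLatticeRep 2) (q i) (x i)).measurable.comp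
      (measurable_torusLift (d := 4) (G := Matrix.specialUnitaryGroup (Fin 2) ℂ) M)).sub (hgm i)
  have hTb : ∀ V, |T V| ≤ (B + D) ^ n := fun V => by
    simp only [hTdef, Finset.abs_prod]
    calc ∏ i, |plane (Matrix.specialUnitaryGroup (Fin 2) ℂ) (fundamentalLatticeRep 2) (q i) (x i) (torusLift M V) - g i (Q V)|
        ≤ ∏ _i : Fin n, (B + D) := Finset.prod_le_prod (fun i _ => abs_nonneg _) fun i _ =>
            (abs_sub _ _).trans (add_le_add (hB _ _ _) (hD _ _))
      _ = (B + D) ^ n := by simp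
  have hint : ∀ χ : GaugeField (F.P K) k (Matrix.specialUnitaryGroup (Fin 2) ℂ) → ℝ,
      Measurable (fun V => χ (Q V)) → (∀ W, |χ W| ≤ 1) → Integrable (fun V => T V * χ (Q V)) μ := fun χ hχm hχb => by
    refine Integrable.mono' (integrable_const ((B + D) ^ n * 1)) (hTm.mul hχm).aestronglyMeasurable
      (Filter.Eventually.of_forall fun V => ?_)
    rw [Real.norm_eq_abs, abs_mul]
    exact mul_le_mul (hTb V) (hχb _) (abs_nonneg _) ((abs_nonneg _).trans (hTb V))
  have hintabs : ∀ χ : GaugeField (F.P K) k (Matrix.specialUnitaryGroup (Fin 2) ℂ) → ℝ,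
      Measurable (fun V => χ (Q V)) → (∀ W, |χ W| ≤ 1) → Integrable (fun V => |χ (Q V)|) μ := fun χ hχm hχb => by
    refine Integrable.mono' (integrable_const (1 : ℝ)) hχm.abs.aestronglyMeasurable (Filter.Eventually.of_forall fun V => ?_)
    rw [Real.norm_eq_abs, abs_abs]; exact hχb _
  -- sum the regimes
  have hI : ∫ V, T V * Ψ (Q V) ∂μ = ∑ S, ∫ V, T V * ΨS S (Q V) ∂μ := by
    rw [← integral_finsetSum _ (fun S _ => hint (ΨS S) (hΨSm S) (hΨSb S))]
    refine integral_congr_ae (Filter.Eventually.of_forall fun V => ?_)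
    simp only
    rw [← Finset.mul_sum, hsumΨ]
  have hIabs : ∫ V, |Ψ (Q V)| ∂μ = ∑ S, ∫ V, |ΨS S (Q V)| ∂μ := by
    rw [← integral_finsetSum _ (fun S _ => hintabs (ΨS S) (hΨSm S) (hΨSb S))]
    exact integral_congr_ae (Filter.Eventually.of_forall fun V => (hsumabs (Q V)).symm)
  show |∫ V, T V * Ψ (Q V) ∂μ| ≤ (C₂ / ((L : ℝ) ^ k) ^ 4) ^ n * ∫ V, |Ψ (Q V)| ∂μ
  rw [hI, hIabs, Finset.mul_sum]
  exact (Finset.abs_sum_le_sum_abs _ _).trans (Finset.sum_le_sum fun S _ => hper S)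


theorem roughFieldDecouplingX_iff : RoughFieldDecouplingX ↔ RoughFieldDecoupling := Iff.rfl

theorem roughFieldDecoupling_of_mixed : MixedRegimeDecoupling → RoughFieldDecoupling :=
  fun h => roughFieldDecouplingX_iff.mp (roughFieldDecoupling_of_mixedX h)

theorem condDecouplingX_iff : CondDecouplingX ↔ CondDecoupling := Iff.rfl

/-- The per-insertion regime glue over the ROUTE decls: `SmallFieldDecoupling` (26272) and `MixedRegimeDecoupling` give the parent
`CondDecoupling` (26017) — the measurability support (26274) is not even needed as a hypothesis (proved inline). -/
theorem condDecoupling_of_regimes : SmallFieldDecoupling → MixedRegimeDecoupling → CondDecoupling :=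
  fun hS hM => condDecouplingX_iff.mp (condDecoupling_of_perInsertionRegimes hS hM)


/-- `CondDecoupling` (26017) from this line's stubs: the per-insertion regime glue applied to the two decoupling stubs. -/
theorem condDecoupling_of_stubs : CondDecoupling :=
  condDecoupling_of_regimes stub_smallFieldDecoupling stub_mixedRegimeDecoupling

/-- The line's composition (the ONLY theorem of this file concluding the crux, so the skeleton audit is unambiguous): the six STUBS
give the spine crux BY NAME — `closes 26018 (condDecoupling_of_regimes 26272 Mixed) 26019 25033 25034` (kernel-checked, no sorry
outside the stubs). -/
theorem UVSeamRec_holds_of_stubs : Summit.QuantumFields.YangMills.Theses.BalabanLadder.UVSeamRec :=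
  Summit.QuantumFields.YangMills.Theses.BalabanFluctuationExport.closes stub_condResponse condDecoupling_of_stubs
    stub_fluctuationExportGlue stub_familySeam stub_floorsEngine

end Summit.QuantumFields.YangMills.Cruxes.UVSeamRec.PerInsertionRegimes
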